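import Summits.RiemannHypothesis.RiemannHypothesis.Theses.WeilSemilocal
import Summits.RiemannHypothesis.RiemannHypothesis.Theorems.ThetaTier1ChebBridgeMain
import Summits.RiemannHypothesis.RiemannHypothesis.Theorems.WeilColumnThetaUCCheb
import Summits.RiemannHypothesis.RiemannHypothesis.Theorems.ThetaTier1CoverSixtyK
import Summits.RiemannHypothesis.RiemannHypothesis.Theorems.WeilSemilocalWallsTenKNonTwin
import Summits.RiemannHypothesis.RiemannHypothesis.Theorems.ThetaTier1ChebRowsSixtyK01
import Summits.RiemannHypothesis.RiemannHypothesis.Theorems.ThetaTier1ChebRowsSixtyK02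
import Summits.RiemannHypothesis.RiemannHypothesis.Theorems.ThetaTier1ChebRowsSixtyK03
import Summits.RiemannHypothesis.RiemannHypothesis.Theorems.ThetaTier1ChebRowsSixtyK04
import Summits.RiemannHypothesis.RiemannHypothesis.Theorems.ThetaTier1ChebRowsSixtyK05
import Summits.RiemannHypothesis.RiemannHypothesis.Theorems.ThetaTier1ChebRowsSixtyK06
import Summits.RiemannHypothesis.RiemannHypothesis.Theorems.ThetaTier1ChebRowsSixtyK07
import Summits.RiemannHypothesis.RiemannHypothesis.Theorems.ThetaTier1ChebRowsSixtyK08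
import Summits.RiemannHypothesis.RiemannHypothesis.Theorems.ThetaTier1ChebRowsSixtyK09
import Summits.RiemannHypothesis.RiemannHypothesis.Theorems.ThetaTier1ChebRowsSixtyK10
import Summits.RiemannHypothesis.RiemannHypothesis.Theorems.ThetaTier1ChebRowsSixtyK11
import Summits.RiemannHypothesis.RiemannHypothesis.Theorems.ThetaTier1ChebRowsSixtyK12
import Summits.RiemannHypothesis.RiemannHypothesis.Theorems.ThetaTier1ChebRowsSixtyK13
import Summits.RiemannHypothesis.RiemannHypothesis.Theorems.ThetaTier1ChebRowsSixtyK14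
import Summits.RiemannHypothesis.RiemannHypothesis.Theorems.ThetaTier1ChebRowsSixtyK15
import Summits.RiemannHypothesis.RiemannHypothesis.Theorems.ThetaTier1ChebRowsSixtyK16
import Summits.RiemannHypothesis.RiemannHypothesis.Theorems.ThetaTier1ChebRowsSixtyK17
import Summits.RiemannHypothesis.RiemannHypothesis.Theorems.ThetaTier1ChebRowsSixtyK18
import Summits.RiemannHypothesis.RiemannHypothesis.Theorems.ThetaTier1ChebRowsSixtyK19
import Summits.RiemannHypothesis.RiemannHypothesis.Theorems.ThetaTier1ChebRowsSixtyK20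
import Summits.RiemannHypothesis.RiemannHypothesis.Theorems.ThetaTier1ChebRowsSixtyK21
import Summits.RiemannHypothesis.RiemannHypothesis.Theorems.ThetaTier1ChebRowsSixtyK22
import Summits.RiemannHypothesis.RiemannHypothesis.Theorems.ThetaTier1ChebRowsSixtyK23
import Summits.RiemannHypothesis.RiemannHypothesis.Theorems.ThetaTier1ChebRowsSixtyK24
import Summits.RiemannHypothesis.RiemannHypothesis.Theorems.ThetaTier1ChebRowsSixtyK25
import Summits.RiemannHypothesis.RiemannHypothesis.Theorems.ThetaTier1ChebRowsSixtyK26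
import Summits.RiemannHypothesis.RiemannHypothesis.Theorems.ThetaTier1ChebRowsSixtyK27
import HarnessLib

/-!
# Route `WeilSemilocal` — CLOSER of the crux `WallsSixtyKNonTwin` (item stmt-RiemannHypothesis-19186; RH-FREE)

FIN of the tier-1 theta certificate (WALLS-II, gap class `≥ 4`): for every prime `10⁴ ≤ q < 6·10⁴` with `q + 2` composite and every
prime `q' > q`, `a*(S_q) = weilSemilocalThreshold (Nat.primesBelow q) < (log q')/2`.  Composition, per kernel row
`r = (q, q⁺, 4, δ·10¹², k)` of the 27 data modules `ThetaTier1ChebRowsSixtyK01 … ThetaTier1ChebRowsSixtyK27` (4222 rows, 106 chunks):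

* DATA (cc-s2-1 gen21, kernel `decide`): `_check : checkAllCheb rows = true` and `_facts' : ∀ r ∈ rows, r.m = 4 ∧ 2 ≤ r.q ∧
  Handoff.ConsecutivePrimes r.q r.qn`;
* (AR) `ThetaTier1.lossCheb_lt_gain_of_checkAllCheb_four` (via the generic chunk lemma `WeilSemilocalRoute.tenKRows_wall_of_checkAllCheb` of the WALLS-I closer) (p438258; RS-free, hypothesis-free): `(ofRow r).Admissible r.qn ∧
  e² ≤ chebN ∧ lossCheb (2^-k) < gain 16`;
* (AN) `ThetaParams.ucCheb_of_lossCheb_lt_gain` (weil-1, p437152; Mathlib's Chebyshev bound, no named fact):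
  `weilSemilocalThreshold (Nat.primesBelow q) < (log q⁺)/2`;
* `q⁺ ≤ q'` for every prime `q' > q` (`ConsecutivePrimes`), monotonicity of `log`;
* COVERAGE `ThetaTier1.sixtyK_cover` (p430282/p434229): every such `q` is listed in `sixtyKQs`, and `sixtyKQs = rows.map Row.q` (kernel).

UPPER clauses of truncated Weil forms only (LADDER-RH W-P(P2), cell `rh-explicit`, typing lane cc-s2-1 gen22); nothing here bears
on the truth of RH.
-/

set_option linter.dupNamespace false  -- the mandated namespace repeats `RiemannHypothesis`
set_option autoImplicit false

namespace Summit.RiemannHypothesis.RiemannHypothesis.Theorems.WeilSemilocalRoute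

open Summit.RiemannHypothesis.RiemannHypothesis.Theorems Summit.RiemannHypothesis.RiemannHypothesis.Theorems.ThetaTier1
open Summit.RiemannHypothesis.RiemannHypothesis.Theorems.WeilColumn.ThetaMellin
open Summit.RiemannHypothesis.RiemannHypothesis.Theorems.MotivicDoor.SemilocalThreshold

/-! The per-row composition (AR) ∘ (AN) and the chunk lemma are the GENERIC theorems landed with the WALLS-I closer
(`WeilSemilocalWallsTenKNonTwin`: `tenK_uc_of_checkAllCheb`, `tenK_wall_of_uc`, `tenKRows_wall_of_checkAllCheb` — generic in the
row list despite the name); they are reused here, not restated. -/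

/-- The coverage list `sixtyKQs` IS the list of abscissae of the 106 data chunks, in order (kernel). [this cell] -/
theorem sixtyKQs_eq_map_rows :
    sixtyKQs = (thetaTier1ChebRowsSixtyK01_1 ++ thetaTier1ChebRowsSixtyK01_2 ++ thetaTier1ChebRowsSixtyK01_3 ++ thetaTier1ChebRowsSixtyK01_4
      ++ thetaTier1ChebRowsSixtyK02_1 ++ thetaTier1ChebRowsSixtyK02_2 ++ thetaTier1ChebRowsSixtyK02_3 ++ thetaTier1ChebRowsSixtyK02_4
      ++ thetaTier1ChebRowsSixtyK03_1 ++ thetaTier1ChebRowsSixtyK03_2 ++ thetaTier1ChebRowsSixtyK03_3 ++ thetaTier1ChebRowsSixtyK03_4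
      ++ thetaTier1ChebRowsSixtyK04_1 ++ thetaTier1ChebRowsSixtyK04_2 ++ thetaTier1ChebRowsSixtyK04_3 ++ thetaTier1ChebRowsSixtyK04_4
      ++ thetaTier1ChebRowsSixtyK05_1 ++ thetaTier1ChebRowsSixtyK05_2 ++ thetaTier1ChebRowsSixtyK05_3 ++ thetaTier1ChebRowsSixtyK05_4
      ++ thetaTier1ChebRowsSixtyK06_1 ++ thetaTier1ChebRowsSixtyK06_2 ++ thetaTier1ChebRowsSixtyK06_3 ++ thetaTier1ChebRowsSixtyK06_4
      ++ thetaTier1ChebRowsSixtyK07_1 ++ thetaTier1ChebRowsSixtyK07_2 ++ thetaTier1ChebRowsSixtyK07_3 ++ thetaTier1ChebRowsSixtyK07_4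
      ++ thetaTier1ChebRowsSixtyK08_1 ++ thetaTier1ChebRowsSixtyK08_2 ++ thetaTier1ChebRowsSixtyK08_3 ++ thetaTier1ChebRowsSixtyK08_4
      ++ thetaTier1ChebRowsSixtyK09_1 ++ thetaTier1ChebRowsSixtyK09_2 ++ thetaTier1ChebRowsSixtyK09_3 ++ thetaTier1ChebRowsSixtyK09_4
      ++ thetaTier1ChebRowsSixtyK10_1 ++ thetaTier1ChebRowsSixtyK10_2 ++ thetaTier1ChebRowsSixtyK10_3 ++ thetaTier1ChebRowsSixtyK10_4
      ++ thetaTier1ChebRowsSixtyK11_1 ++ thetaTier1ChebRowsSixtyK11_2 ++ thetaTier1ChebRowsSixtyK11_3 ++ thetaTier1ChebRowsSixtyK11_4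
      ++ thetaTier1ChebRowsSixtyK12_1 ++ thetaTier1ChebRowsSixtyK12_2 ++ thetaTier1ChebRowsSixtyK12_3 ++ thetaTier1ChebRowsSixtyK12_4
      ++ thetaTier1ChebRowsSixtyK13_1 ++ thetaTier1ChebRowsSixtyK13_2 ++ thetaTier1ChebRowsSixtyK13_3 ++ thetaTier1ChebRowsSixtyK13_4
      ++ thetaTier1ChebRowsSixtyK14_1 ++ thetaTier1ChebRowsSixtyK14_2 ++ thetaTier1ChebRowsSixtyK14_3 ++ thetaTier1ChebRowsSixtyK14_4
      ++ thetaTier1ChebRowsSixtyK15_1 ++ thetaTier1ChebRowsSixtyK15_2 ++ thetaTier1ChebRowsSixtyK15_3 ++ thetaTier1ChebRowsSixtyK15_4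
      ++ thetaTier1ChebRowsSixtyK16_1 ++ thetaTier1ChebRowsSixtyK16_2 ++ thetaTier1ChebRowsSixtyK16_3 ++ thetaTier1ChebRowsSixtyK16_4
      ++ thetaTier1ChebRowsSixtyK17_1 ++ thetaTier1ChebRowsSixtyK17_2 ++ thetaTier1ChebRowsSixtyK17_3 ++ thetaTier1ChebRowsSixtyK17_4
      ++ thetaTier1ChebRowsSixtyK18_1 ++ thetaTier1ChebRowsSixtyK18_2 ++ thetaTier1ChebRowsSixtyK18_3 ++ thetaTier1ChebRowsSixtyK18_4
      ++ thetaTier1ChebRowsSixtyK19_1 ++ thetaTier1ChebRowsSixtyK19_2 ++ thetaTier1ChebRowsSixtyK19_3 ++ thetaTier1ChebRowsSixtyK19_4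
      ++ thetaTier1ChebRowsSixtyK20_1 ++ thetaTier1ChebRowsSixtyK20_2 ++ thetaTier1ChebRowsSixtyK20_3 ++ thetaTier1ChebRowsSixtyK20_4
      ++ thetaTier1ChebRowsSixtyK21_1 ++ thetaTier1ChebRowsSixtyK21_2 ++ thetaTier1ChebRowsSixtyK21_3 ++ thetaTier1ChebRowsSixtyK21_4
      ++ thetaTier1ChebRowsSixtyK22_1 ++ thetaTier1ChebRowsSixtyK22_2 ++ thetaTier1ChebRowsSixtyK22_3 ++ thetaTier1ChebRowsSixtyK22_4
      ++ thetaTier1ChebRowsSixtyK23_1 ++ thetaTier1ChebRowsSixtyK23_2 ++ thetaTier1ChebRowsSixtyK23_3 ++ thetaTier1ChebRowsSixtyK23_4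
      ++ thetaTier1ChebRowsSixtyK24_1 ++ thetaTier1ChebRowsSixtyK24_2 ++ thetaTier1ChebRowsSixtyK24_3 ++ thetaTier1ChebRowsSixtyK24_4
      ++ thetaTier1ChebRowsSixtyK25_1 ++ thetaTier1ChebRowsSixtyK25_2 ++ thetaTier1ChebRowsSixtyK25_3 ++ thetaTier1ChebRowsSixtyK25_4
      ++ thetaTier1ChebRowsSixtyK26_1 ++ thetaTier1ChebRowsSixtyK26_2 ++ thetaTier1ChebRowsSixtyK26_3 ++ thetaTier1ChebRowsSixtyK26_4
      ++ thetaTier1ChebRowsSixtyK27_1 ++ thetaTier1ChebRowsSixtyK27_2).map Row.q := by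
  decide +kernel

/-- **C-I(a) at every listed abscissa**: for `q ∈ sixtyKQs` and every prime `q' > q`, `a*(S_q) < (log q')/2`. [this cell] -/
theorem sixtyK_walls : ∀ q ∈ sixtyKQs, ∀ q' : ℕ, q'.Prime → q < q' →
    weilSemilocalThreshold (Nat.primesBelow q) < Real.log q' / 2 := by
  rw [sixtyKQs_eq_map_rows]
  simp only [List.map_append, List.forall_mem_append, List.forall_mem_map, and_assoc]
  exact ⟨tenKRows_wall_of_checkAllCheb thetaTier1ChebRowsSixtyK01_1_check thetaTier1ChebRowsSixtyK01_1_facts',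
    tenKRows_wall_of_checkAllCheb thetaTier1ChebRowsSixtyK01_2_check thetaTier1ChebRowsSixtyK01_2_facts',
    tenKRows_wall_of_checkAllCheb thetaTier1ChebRowsSixtyK01_3_check thetaTier1ChebRowsSixtyK01_3_facts',
    tenKRows_wall_of_checkAllCheb thetaTier1ChebRowsSixtyK01_4_check thetaTier1ChebRowsSixtyK01_4_facts',
    tenKRows_wall_of_checkAllCheb thetaTier1ChebRowsSixtyK02_1_check thetaTier1ChebRowsSixtyK02_1_facts',
    tenKRows_wall_of_checkAllCheb thetaTier1ChebRowsSixtyK02_2_check thetaTier1ChebRowsSixtyK02_2_facts',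
    tenKRows_wall_of_checkAllCheb thetaTier1ChebRowsSixtyK02_3_check thetaTier1ChebRowsSixtyK02_3_facts',
    tenKRows_wall_of_checkAllCheb thetaTier1ChebRowsSixtyK02_4_check thetaTier1ChebRowsSixtyK02_4_facts',
    tenKRows_wall_of_checkAllCheb thetaTier1ChebRowsSixtyK03_1_check thetaTier1ChebRowsSixtyK03_1_facts',
    tenKRows_wall_of_checkAllCheb thetaTier1ChebRowsSixtyK03_2_check thetaTier1ChebRowsSixtyK03_2_facts',
    tenKRows_wall_of_checkAllCheb thetaTier1ChebRowsSixtyK03_3_check thetaTier1ChebRowsSixtyK03_3_facts',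
    tenKRows_wall_of_checkAllCheb thetaTier1ChebRowsSixtyK03_4_check thetaTier1ChebRowsSixtyK03_4_facts',
    tenKRows_wall_of_checkAllCheb thetaTier1ChebRowsSixtyK04_1_check thetaTier1ChebRowsSixtyK04_1_facts',
    tenKRows_wall_of_checkAllCheb thetaTier1ChebRowsSixtyK04_2_check thetaTier1ChebRowsSixtyK04_2_facts',
    tenKRows_wall_of_checkAllCheb thetaTier1ChebRowsSixtyK04_3_check thetaTier1ChebRowsSixtyK04_3_facts',
    tenKRows_wall_of_checkAllCheb thetaTier1ChebRowsSixtyK04_4_check thetaTier1ChebRowsSixtyK04_4_facts',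
    tenKRows_wall_of_checkAllCheb thetaTier1ChebRowsSixtyK05_1_check thetaTier1ChebRowsSixtyK05_1_facts',
    tenKRows_wall_of_checkAllCheb thetaTier1ChebRowsSixtyK05_2_check thetaTier1ChebRowsSixtyK05_2_facts',
    tenKRows_wall_of_checkAllCheb thetaTier1ChebRowsSixtyK05_3_check thetaTier1ChebRowsSixtyK05_3_facts',
    tenKRows_wall_of_checkAllCheb thetaTier1ChebRowsSixtyK05_4_check thetaTier1ChebRowsSixtyK05_4_facts',
    tenKRows_wall_of_checkAllCheb thetaTier1ChebRowsSixtyK06_1_check thetaTier1ChebRowsSixtyK06_1_facts',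
    tenKRows_wall_of_checkAllCheb thetaTier1ChebRowsSixtyK06_2_check thetaTier1ChebRowsSixtyK06_2_facts',
    tenKRows_wall_of_checkAllCheb thetaTier1ChebRowsSixtyK06_3_check thetaTier1ChebRowsSixtyK06_3_facts',
    tenKRows_wall_of_checkAllCheb thetaTier1ChebRowsSixtyK06_4_check thetaTier1ChebRowsSixtyK06_4_facts',
    tenKRows_wall_of_checkAllCheb thetaTier1ChebRowsSixtyK07_1_check thetaTier1ChebRowsSixtyK07_1_facts',
    tenKRows_wall_of_checkAllCheb thetaTier1ChebRowsSixtyK07_2_check thetaTier1ChebRowsSixtyK07_2_facts',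
    tenKRows_wall_of_checkAllCheb thetaTier1ChebRowsSixtyK07_3_check thetaTier1ChebRowsSixtyK07_3_facts',
    tenKRows_wall_of_checkAllCheb thetaTier1ChebRowsSixtyK07_4_check thetaTier1ChebRowsSixtyK07_4_facts',
    tenKRows_wall_of_checkAllCheb thetaTier1ChebRowsSixtyK08_1_check thetaTier1ChebRowsSixtyK08_1_facts',
    tenKRows_wall_of_checkAllCheb thetaTier1ChebRowsSixtyK08_2_check thetaTier1ChebRowsSixtyK08_2_facts',
    tenKRows_wall_of_checkAllCheb thetaTier1ChebRowsSixtyK08_3_check thetaTier1ChebRowsSixtyK08_3_facts',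
    tenKRows_wall_of_checkAllCheb thetaTier1ChebRowsSixtyK08_4_check thetaTier1ChebRowsSixtyK08_4_facts',
    tenKRows_wall_of_checkAllCheb thetaTier1ChebRowsSixtyK09_1_check thetaTier1ChebRowsSixtyK09_1_facts',
    tenKRows_wall_of_checkAllCheb thetaTier1ChebRowsSixtyK09_2_check thetaTier1ChebRowsSixtyK09_2_facts',
    tenKRows_wall_of_checkAllCheb thetaTier1ChebRowsSixtyK09_3_check thetaTier1ChebRowsSixtyK09_3_facts',
    tenKRows_wall_of_checkAllCheb thetaTier1ChebRowsSixtyK09_4_check thetaTier1ChebRowsSixtyK09_4_facts',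
    tenKRows_wall_of_checkAllCheb thetaTier1ChebRowsSixtyK10_1_check thetaTier1ChebRowsSixtyK10_1_facts',
    tenKRows_wall_of_checkAllCheb thetaTier1ChebRowsSixtyK10_2_check thetaTier1ChebRowsSixtyK10_2_facts',
    tenKRows_wall_of_checkAllCheb thetaTier1ChebRowsSixtyK10_3_check thetaTier1ChebRowsSixtyK10_3_facts',
    tenKRows_wall_of_checkAllCheb thetaTier1ChebRowsSixtyK10_4_check thetaTier1ChebRowsSixtyK10_4_facts',
    tenKRows_wall_of_checkAllCheb thetaTier1ChebRowsSixtyK11_1_check thetaTier1ChebRowsSixtyK11_1_facts',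
    tenKRows_wall_of_checkAllCheb thetaTier1ChebRowsSixtyK11_2_check thetaTier1ChebRowsSixtyK11_2_facts',
    tenKRows_wall_of_checkAllCheb thetaTier1ChebRowsSixtyK11_3_check thetaTier1ChebRowsSixtyK11_3_facts',
    tenKRows_wall_of_checkAllCheb thetaTier1ChebRowsSixtyK11_4_check thetaTier1ChebRowsSixtyK11_4_facts',
    tenKRows_wall_of_checkAllCheb thetaTier1ChebRowsSixtyK12_1_check thetaTier1ChebRowsSixtyK12_1_facts',
    tenKRows_wall_of_checkAllCheb thetaTier1ChebRowsSixtyK12_2_check thetaTier1ChebRowsSixtyK12_2_facts',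
    tenKRows_wall_of_checkAllCheb thetaTier1ChebRowsSixtyK12_3_check thetaTier1ChebRowsSixtyK12_3_facts',
    tenKRows_wall_of_checkAllCheb thetaTier1ChebRowsSixtyK12_4_check thetaTier1ChebRowsSixtyK12_4_facts',
    tenKRows_wall_of_checkAllCheb thetaTier1ChebRowsSixtyK13_1_check thetaTier1ChebRowsSixtyK13_1_facts',
    tenKRows_wall_of_checkAllCheb thetaTier1ChebRowsSixtyK13_2_check thetaTier1ChebRowsSixtyK13_2_facts',
    tenKRows_wall_of_checkAllCheb thetaTier1ChebRowsSixtyK13_3_check thetaTier1ChebRowsSixtyK13_3_facts',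
    tenKRows_wall_of_checkAllCheb thetaTier1ChebRowsSixtyK13_4_check thetaTier1ChebRowsSixtyK13_4_facts',
    tenKRows_wall_of_checkAllCheb thetaTier1ChebRowsSixtyK14_1_check thetaTier1ChebRowsSixtyK14_1_facts',
    tenKRows_wall_of_checkAllCheb thetaTier1ChebRowsSixtyK14_2_check thetaTier1ChebRowsSixtyK14_2_facts',
    tenKRows_wall_of_checkAllCheb thetaTier1ChebRowsSixtyK14_3_check thetaTier1ChebRowsSixtyK14_3_facts',
    tenKRows_wall_of_checkAllCheb thetaTier1ChebRowsSixtyK14_4_check thetaTier1ChebRowsSixtyK14_4_facts',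
    tenKRows_wall_of_checkAllCheb thetaTier1ChebRowsSixtyK15_1_check thetaTier1ChebRowsSixtyK15_1_facts',
    tenKRows_wall_of_checkAllCheb thetaTier1ChebRowsSixtyK15_2_check thetaTier1ChebRowsSixtyK15_2_facts',
    tenKRows_wall_of_checkAllCheb thetaTier1ChebRowsSixtyK15_3_check thetaTier1ChebRowsSixtyK15_3_facts',
    tenKRows_wall_of_checkAllCheb thetaTier1ChebRowsSixtyK15_4_check thetaTier1ChebRowsSixtyK15_4_facts',
    tenKRows_wall_of_checkAllCheb thetaTier1ChebRowsSixtyK16_1_check thetaTier1ChebRowsSixtyK16_1_facts',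
    tenKRows_wall_of_checkAllCheb thetaTier1ChebRowsSixtyK16_2_check thetaTier1ChebRowsSixtyK16_2_facts',
    tenKRows_wall_of_checkAllCheb thetaTier1ChebRowsSixtyK16_3_check thetaTier1ChebRowsSixtyK16_3_facts',
    tenKRows_wall_of_checkAllCheb thetaTier1ChebRowsSixtyK16_4_check thetaTier1ChebRowsSixtyK16_4_facts',
    tenKRows_wall_of_checkAllCheb thetaTier1ChebRowsSixtyK17_1_check thetaTier1ChebRowsSixtyK17_1_facts',
    tenKRows_wall_of_checkAllCheb thetaTier1ChebRowsSixtyK17_2_check thetaTier1ChebRowsSixtyK17_2_facts',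
    tenKRows_wall_of_checkAllCheb thetaTier1ChebRowsSixtyK17_3_check thetaTier1ChebRowsSixtyK17_3_facts',
    tenKRows_wall_of_checkAllCheb thetaTier1ChebRowsSixtyK17_4_check thetaTier1ChebRowsSixtyK17_4_facts',
    tenKRows_wall_of_checkAllCheb thetaTier1ChebRowsSixtyK18_1_check thetaTier1ChebRowsSixtyK18_1_facts',
    tenKRows_wall_of_checkAllCheb thetaTier1ChebRowsSixtyK18_2_check thetaTier1ChebRowsSixtyK18_2_facts',
    tenKRows_wall_of_checkAllCheb thetaTier1ChebRowsSixtyK18_3_check thetaTier1ChebRowsSixtyK18_3_facts',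
    tenKRows_wall_of_checkAllCheb thetaTier1ChebRowsSixtyK18_4_check thetaTier1ChebRowsSixtyK18_4_facts',
    tenKRows_wall_of_checkAllCheb thetaTier1ChebRowsSixtyK19_1_check thetaTier1ChebRowsSixtyK19_1_facts',
    tenKRows_wall_of_checkAllCheb thetaTier1ChebRowsSixtyK19_2_check thetaTier1ChebRowsSixtyK19_2_facts',
    tenKRows_wall_of_checkAllCheb thetaTier1ChebRowsSixtyK19_3_check thetaTier1ChebRowsSixtyK19_3_facts',
    tenKRows_wall_of_checkAllCheb thetaTier1ChebRowsSixtyK19_4_check thetaTier1ChebRowsSixtyK19_4_facts',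
    tenKRows_wall_of_checkAllCheb thetaTier1ChebRowsSixtyK20_1_check thetaTier1ChebRowsSixtyK20_1_facts',
    tenKRows_wall_of_checkAllCheb thetaTier1ChebRowsSixtyK20_2_check thetaTier1ChebRowsSixtyK20_2_facts',
    tenKRows_wall_of_checkAllCheb thetaTier1ChebRowsSixtyK20_3_check thetaTier1ChebRowsSixtyK20_3_facts',
    tenKRows_wall_of_checkAllCheb thetaTier1ChebRowsSixtyK20_4_check thetaTier1ChebRowsSixtyK20_4_facts',
    tenKRows_wall_of_checkAllCheb thetaTier1ChebRowsSixtyK21_1_check thetaTier1ChebRowsSixtyK21_1_facts',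
    tenKRows_wall_of_checkAllCheb thetaTier1ChebRowsSixtyK21_2_check thetaTier1ChebRowsSixtyK21_2_facts',
    tenKRows_wall_of_checkAllCheb thetaTier1ChebRowsSixtyK21_3_check thetaTier1ChebRowsSixtyK21_3_facts',
    tenKRows_wall_of_checkAllCheb thetaTier1ChebRowsSixtyK21_4_check thetaTier1ChebRowsSixtyK21_4_facts',
    tenKRows_wall_of_checkAllCheb thetaTier1ChebRowsSixtyK22_1_check thetaTier1ChebRowsSixtyK22_1_facts',
    tenKRows_wall_of_checkAllCheb thetaTier1ChebRowsSixtyK22_2_check thetaTier1ChebRowsSixtyK22_2_facts',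
    tenKRows_wall_of_checkAllCheb thetaTier1ChebRowsSixtyK22_3_check thetaTier1ChebRowsSixtyK22_3_facts',
    tenKRows_wall_of_checkAllCheb thetaTier1ChebRowsSixtyK22_4_check thetaTier1ChebRowsSixtyK22_4_facts',
    tenKRows_wall_of_checkAllCheb thetaTier1ChebRowsSixtyK23_1_check thetaTier1ChebRowsSixtyK23_1_facts',
    tenKRows_wall_of_checkAllCheb thetaTier1ChebRowsSixtyK23_2_check thetaTier1ChebRowsSixtyK23_2_facts',
    tenKRows_wall_of_checkAllCheb thetaTier1ChebRowsSixtyK23_3_check thetaTier1ChebRowsSixtyK23_3_facts',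
    tenKRows_wall_of_checkAllCheb thetaTier1ChebRowsSixtyK23_4_check thetaTier1ChebRowsSixtyK23_4_facts',
    tenKRows_wall_of_checkAllCheb thetaTier1ChebRowsSixtyK24_1_check thetaTier1ChebRowsSixtyK24_1_facts',
    tenKRows_wall_of_checkAllCheb thetaTier1ChebRowsSixtyK24_2_check thetaTier1ChebRowsSixtyK24_2_facts',
    tenKRows_wall_of_checkAllCheb thetaTier1ChebRowsSixtyK24_3_check thetaTier1ChebRowsSixtyK24_3_facts',
    tenKRows_wall_of_checkAllCheb thetaTier1ChebRowsSixtyK24_4_check thetaTier1ChebRowsSixtyK24_4_facts',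
    tenKRows_wall_of_checkAllCheb thetaTier1ChebRowsSixtyK25_1_check thetaTier1ChebRowsSixtyK25_1_facts',
    tenKRows_wall_of_checkAllCheb thetaTier1ChebRowsSixtyK25_2_check thetaTier1ChebRowsSixtyK25_2_facts',
    tenKRows_wall_of_checkAllCheb thetaTier1ChebRowsSixtyK25_3_check thetaTier1ChebRowsSixtyK25_3_facts',
    tenKRows_wall_of_checkAllCheb thetaTier1ChebRowsSixtyK25_4_check thetaTier1ChebRowsSixtyK25_4_facts',
    tenKRows_wall_of_checkAllCheb thetaTier1ChebRowsSixtyK26_1_check thetaTier1ChebRowsSixtyK26_1_facts',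
    tenKRows_wall_of_checkAllCheb thetaTier1ChebRowsSixtyK26_2_check thetaTier1ChebRowsSixtyK26_2_facts',
    tenKRows_wall_of_checkAllCheb thetaTier1ChebRowsSixtyK26_3_check thetaTier1ChebRowsSixtyK26_3_facts',
    tenKRows_wall_of_checkAllCheb thetaTier1ChebRowsSixtyK26_4_check thetaTier1ChebRowsSixtyK26_4_facts',
    tenKRows_wall_of_checkAllCheb thetaTier1ChebRowsSixtyK27_1_check thetaTier1ChebRowsSixtyK27_1_facts',
    tenKRows_wall_of_checkAllCheb thetaTier1ChebRowsSixtyK27_2_check thetaTier1ChebRowsSixtyK27_2_facts'⟩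

/-- **CLOSER of the crux `WallsSixtyKNonTwin`** (item stmt-RiemannHypothesis-19186, `route-RiemannHypothesis-WeilSemilocal`): C-I(a) at every
prime `10⁴ ≤ q < 6·10⁴` of gap `≥ 4`. [this cell; tier-1 theta certificate, (AR) p438258 ∘ (AN) p437152 over 4222 kernel rows] -/
theorem wallsSixtyKNonTwin_proof :
    Summit.RiemannHypothesis.RiemannHypothesis.Theses.WeilSemilocal.WallsSixtyKNonTwin := by
  unfold Theses.WeilSemilocal.WallsSixtyKNonTwin
  intro q hq hlo hhi hn
  exact sixtyK_walls q (sixtyK_cover q hlo hhi hq hn)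

end Summit.RiemannHypothesis.RiemannHypothesis.Theorems.WeilSemilocalRoute
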